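import Literature.Analysis.FluidPDE.FluidComputer.CircuitArchitecture
import Literature.Analysis.FluidPDE.FluidComputer.TypeOneNumber
import HarnessLib

/-!
# Fluid computer blueprint — what the STATICS of a shadowed circuit design force

HONEST FRAMING: low prior, high value-of-information experiment on Tao's machine paradigm; NOT a
claim that NS blows up. Nothing here constructs a design; these are constraints every inhabitant
of `ShadowedCircuit S O s` (if any) must satisfy — they say what the idea-bound axioms
`shadow` / `leak` have to tolerate.

* **F1 (`junk_le_jrun_of_onTrajectory`, `jin_le_jrun`).** `leak` at rescaled time `σ = 0`: a
  trajectory state read in `Ain` with junk `≤ jin √E_n` has junk `≤ jrun √E_n`; if some trajectory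
  state sits exactly at the loading threshold, `jin ≤ jrun`.
* **F2 (`forgetting`, `no_faithful_junk`).** Along any one-parameter family of states that the
  generation-`n` readout does not see (it reads a fixed `p ∈ Aout`), on which the generation-`n`
  junk grows at most at rate `c > 0` and the generation-`(n+1)` junk at least at rate `c'`,
  `handoff` forces `c' · jrun · √E_n ≤ c · jcore · √E_{n+1}`: the weight of a readout-null
  ("debris") direction must DROP by at least the factor `(jcore / jrun) · √η < 1` per generation.
  A junk functional FAITHFUL on such a family (`c' = c`; e.g. a full `X^s`-distance to the design
  state or to a design orbit) is inconsistent with `jcore < jin ≤ jrun`. The statics can only be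
  met by a junk that forgets the ancestors' debris geometrically — erasure cannot be demanded of
  the true flow, tolerance must be (and is then carried by the idea-bound `shadow` / `leak`).
* **Sweeping load (`CascadeSpecs.sweepingLoad`).** `S(η) = √(1-η) / (√(8η) - 1)`, the sum of the
  geometric series `Σ_{j ≥ 1} √(1-η) (8η)^{-j/2}` (`sweepingLoad_hasSum`, `η > 1/8`): with closure,
  `c · S(η)` machine-lengths bounds the displacement of a generation by all its ancestors' debris
  over one tick (ASSEMBLY §2g.5, informal derivation); `robustnessLoad ≤ sweepingLoad`.
[cite: Tao2016AveragedNS, §1.3 pp. 10–11 (obstruction (i): junk left behind by earlier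
generations)]
-/

noncomputable section

open MeasureTheory Set Filter Topology
open scoped ENNReal NNReal

namespace Literature.Analysis.FluidPDE.FluidComputer

open Literature.Analysis.FluidPDE.Tao2016

namespace ShadowedCircuit

variable {S : CascadeSpecs} {O : Type*} [PseudoMetricSpace O] {s : ℝ} (A : ShadowedCircuit S O s)

/-- `0 < jin` (since `0 ≤ jcore < jin`). [folklore] -/
theorem jin_pos : 0 < A.jin := lt_of_le_of_lt A.jcore_nonneg A.jcore_lt

/-- **F1.** A state on a mild Navier–Stokes trajectory (time `0 ≤ t <` lifespan) read in `Ain` with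
junk `≤ jin √E_n` has junk `≤ jrun √E_n`: the field `leak` at rescaled time `0`. [folklore] -/
theorem junk_le_jrun_of_onTrajectory (n : ℕ) {a : L2C} {S' : ℝ} {u : ℝ → L2C}
    (hu : IsMildSolutionFor eulerForm a (Ico 0 S') u) {t : ℝ} (ht : 0 ≤ t) (htS : t < S')
    (hread : A.read n (u t) ∈ A.Ain)
    (hjunk : A.junk n (u t) ≤ ENNReal.ofReal (A.jin * Real.sqrt (S.Emin n))) :
    A.junk n (u t) ≤ ENNReal.ofReal (A.jrun * Real.sqrt (S.Emin n)) := by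
  have h := A.leak n a S' u hu t ht hread hjunk 0 le_rfl A.τc_nonneg (by simpa using htS)
  simpa using h

/-- **F1, threshold form.** If some trajectory state is read in `Ain` with junk EXACTLY at the
loading threshold `jin √E_n`, then `jin ≤ jrun`. [folklore] -/
theorem jin_le_jrun (n : ℕ) {a : L2C} {S' : ℝ} {u : ℝ → L2C}
    (hu : IsMildSolutionFor eulerForm a (Ico 0 S') u) {t : ℝ} (ht : 0 ≤ t) (htS : t < S')
    (hread : A.read n (u t) ∈ A.Ain)
    (hjunk : A.junk n (u t) = ENNReal.ofReal (A.jin * Real.sqrt (S.Emin n))) :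
    A.jin ≤ A.jrun := by
  have h := A.junk_le_jrun_of_onTrajectory n hu ht htS hread hjunk.le
  rw [hjunk] at h
  have hE : 0 < Real.sqrt (S.Emin n) := Real.sqrt_pos.2 (S.Emin_pos n)
  have hpos : 0 < A.jin * Real.sqrt (S.Emin n) := mul_pos A.jin_pos hE
  rcases (ENNReal.ofReal_le_ofReal_iff'.1 h) with h2 | h2
  · exact le_of_mul_le_mul_right h2 hE
  · exact absurd h2 (not_le.2 hpos)

/-- **F2 (forced forgetting).** Let `γ` be a family of states, indexed by `θ ≥ 0`, all read as the
same output point `p ∈ Aout` at generation `n`, on which the generation-`n` junk is `≤ c θ`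
(`c > 0`) and the generation-`(n+1)` junk is `≥ c' θ`. Then `handoff` (applied at
`θ = jrun √E_n / c`) forces `c' · jrun · √E_n ≤ c · jcore · √E_{n+1}`. [folklore] -/
theorem forgetting (n : ℕ) {p : O} (hp : p ∈ A.Aout) (γ : ℝ → L2C) {c c' : ℝ} (hc : 0 < c)
    (hjrun : 0 ≤ A.jrun)
    (hread : ∀ θ : ℝ, 0 ≤ θ → A.read n (γ θ) = p)
    (hjunk : ∀ θ : ℝ, 0 ≤ θ → A.junk n (γ θ) ≤ ENNReal.ofReal (c * θ))
    (hjunk' : ∀ θ : ℝ, 0 ≤ θ → ENNReal.ofReal (c' * θ) ≤ A.junk (n + 1) (γ θ)) :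
    c' * A.jrun * Real.sqrt (S.Emin n) ≤ c * A.jcore * Real.sqrt (S.Emin (n + 1)) := by
  set θ : ℝ := A.jrun * Real.sqrt (S.Emin n) / c with hθ
  have hθ0 : 0 ≤ θ := div_nonneg (mul_nonneg hjrun (Real.sqrt_nonneg _)) hc.le
  have hcθ : c * θ = A.jrun * Real.sqrt (S.Emin n) := by
    rw [hθ]; field_simp
  have h1 : A.junk n (γ θ) ≤ ENNReal.ofReal (A.jrun * Real.sqrt (S.Emin n)) := by
    rw [← hcθ]; exact hjunk θ hθ0
  have hAout : A.read n (γ θ) ∈ A.Aout := by rw [hread θ hθ0]; exact hp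
  have h2 := (A.handoff n (γ θ) hAout h1).2
  have h3 : ENNReal.ofReal (c' * θ) ≤ ENNReal.ofReal (A.jcore * Real.sqrt (S.Emin (n + 1))) :=
    (hjunk' θ hθ0).trans h2
  have h4 : c' * θ ≤ A.jcore * Real.sqrt (S.Emin (n + 1)) :=
    (ENNReal.ofReal_le_ofReal_iff (mul_nonneg A.jcore_nonneg (Real.sqrt_nonneg _))).1 h3
  calc c' * A.jrun * Real.sqrt (S.Emin n) = c' * (c * θ) := by rw [hcθ]; ring
    _ = (c' * θ) * c := by ring
    _ ≤ (A.jcore * Real.sqrt (S.Emin (n + 1))) * c := mul_le_mul_of_nonneg_right h4 hc.le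
    _ = c * A.jcore * Real.sqrt (S.Emin (n + 1)) := by ring

/-- **F2, ratio form.** Under the hypotheses of `forgetting` with `jrun > 0`:
`c' ≤ c · (jcore / jrun) · √η` — the per-generation discount of a readout-null direction.
[folklore] -/
theorem forgetting_ratio (n : ℕ) {p : O} (hp : p ∈ A.Aout) (γ : ℝ → L2C) {c c' : ℝ} (hc : 0 < c)
    (hjrun : 0 < A.jrun)
    (hread : ∀ θ : ℝ, 0 ≤ θ → A.read n (γ θ) = p)
    (hjunk : ∀ θ : ℝ, 0 ≤ θ → A.junk n (γ θ) ≤ ENNReal.ofReal (c * θ))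
    (hjunk' : ∀ θ : ℝ, 0 ≤ θ → ENNReal.ofReal (c' * θ) ≤ A.junk (n + 1) (γ θ)) :
    c' ≤ c * (A.jcore / A.jrun) * Real.sqrt S.eta := by
  have h := A.forgetting n hp γ hc hjrun.le hread hjunk hjunk'
  have hE : 0 < Real.sqrt (S.Emin n) := Real.sqrt_pos.2 (S.Emin_pos n)
  have hs : Real.sqrt (S.Emin (n + 1)) = Real.sqrt S.eta * Real.sqrt (S.Emin n) := by
    rw [S.Emin_succ, Real.sqrt_mul S.eta_pos.le]
  rw [hs] at h
  have hden : 0 < A.jrun * Real.sqrt (S.Emin n) := mul_pos hjrun hE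
  rw [show c * (A.jcore / A.jrun) * Real.sqrt S.eta
      = c * A.jcore * Real.sqrt S.eta * Real.sqrt (S.Emin n) / (A.jrun * Real.sqrt (S.Emin n)) by
    field_simp]
  rw [le_div_iff₀ hden]
  calc c' * (A.jrun * Real.sqrt (S.Emin n)) = c' * A.jrun * Real.sqrt (S.Emin n) := by ring
    _ ≤ c * A.jcore * (Real.sqrt S.eta * Real.sqrt (S.Emin n)) := h
    _ = c * A.jcore * Real.sqrt S.eta * Real.sqrt (S.Emin n) := by ring

/-- **F2, corollary: a FAITHFUL junk is inconsistent.** If the junk functional weighs some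
readout-null family at generation `n + 1` at least as much as at generation `n` (`c' = c > 0`) and
`jin ≤ jrun` (F1), the statics cannot hold: `forgetting` would give `jrun ≤ jcore √η ≤ jcore < jin`.
[folklore] -/
theorem no_faithful_junk (n : ℕ) {p : O} (hp : p ∈ A.Aout) (γ : ℝ → L2C) {c : ℝ} (hc : 0 < c)
    (hjin : A.jin ≤ A.jrun)
    (hread : ∀ θ : ℝ, 0 ≤ θ → A.read n (γ θ) = p)
    (hjunk : ∀ θ : ℝ, 0 ≤ θ → A.junk n (γ θ) ≤ ENNReal.ofReal (c * θ))
    (hjunk' : ∀ θ : ℝ, 0 ≤ θ → ENNReal.ofReal (c * θ) ≤ A.junk (n + 1) (γ θ)) : False := by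
  have hjrun : 0 ≤ A.jrun := A.jin_pos.le.trans hjin
  have h := A.forgetting n hp γ hc hjrun hread hjunk hjunk'
  have hE : 0 < Real.sqrt (S.Emin n) := Real.sqrt_pos.2 (S.Emin_pos n)
  have hs : Real.sqrt (S.Emin (n + 1)) ≤ Real.sqrt (S.Emin n) := by
    apply Real.sqrt_le_sqrt
    rw [S.Emin_succ]
    exact mul_le_of_le_one_left (S.Emin_pos n).le S.eta_le_one
  have h2 : c * A.jrun * Real.sqrt (S.Emin n) ≤ c * A.jcore * Real.sqrt (S.Emin n) :=
    h.trans (mul_le_mul_of_nonneg_left hs (mul_nonneg hc.le A.jcore_nonneg))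
  have hcE : 0 < c * Real.sqrt (S.Emin n) := mul_pos hc hE
  have h3 : A.jrun ≤ A.jcore := by
    by_contra hlt
    nlinarith [h2, hcE, not_le.1 hlt]
  linarith [A.jcore_lt]

end ShadowedCircuit

/-! ### The sweeping load -/

namespace CascadeSpecs

variable (S : CascadeSpecs)

/-- The **sweeping load** `S(η) = √(1-η) / (√(8η) - 1)`: with closure (`α = 5/2 + ½ log₂ η`), the
bound `Σ_{j ≥ 1} √(1-η) (8η)^{-j/2}` on the displacement (in machine-lengths, per unit relative
debris amplitude `c`) of a generation by the large-scale debris of ALL its ancestors during one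
tick. Finite iff `η > 1/8`. [folklore] -/
def sweepingLoad : ℝ := Real.sqrt (1 - S.eta) / (Real.sqrt (8 * S.eta) - 1)

/-- `1 < √(8η)` once `η > 1/8`. [folklore] -/
theorem one_lt_sqrt_eight_mul (hη : 1 / 8 < S.eta) : 1 < Real.sqrt (8 * S.eta) := by
  rw [show (1 : ℝ) = Real.sqrt 1 from Real.sqrt_one.symm]
  exact Real.sqrt_lt_sqrt zero_le_one (by linarith)

/-- `S(η) ≥ 0` once `η > 1/8`. [folklore] -/
theorem sweepingLoad_nonneg (hη : 1 / 8 < S.eta) : 0 ≤ S.sweepingLoad := by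
  unfold sweepingLoad
  exact div_nonneg (Real.sqrt_nonneg _) (by linarith [S.one_lt_sqrt_eight_mul hη])

/-- The strain load is dominated by the sweeping load: `L(η) ≤ S(η)` for `η > 1/8`
(`√(32η) - 1 ≥ √(8η) - 1 > 0`). [folklore] -/
theorem robustnessLoad_le_sweepingLoad (hη : 1 / 8 < S.eta) : S.robustnessLoad ≤ S.sweepingLoad := by
  unfold robustnessLoad sweepingLoad
  have h1 : 1 < Real.sqrt (8 * S.eta) := S.one_lt_sqrt_eight_mul hη
  have h2 : Real.sqrt (8 * S.eta) ≤ Real.sqrt (32 * S.eta) :=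
    Real.sqrt_le_sqrt (by linarith [S.eta_pos])
  exact div_le_div_of_nonneg_left (Real.sqrt_nonneg _) (by linarith) (by linarith)

/-- `S(η)` is the sum of the geometric series `Σ_{j ≥ 0} √(1-η) · (√(8η))^{-(j+1)}` (ages `≥ 1`).
[folklore] -/
theorem sweepingLoad_hasSum (hη : 1 / 8 < S.eta) :
    HasSum (fun j : ℕ => Real.sqrt (1 - S.eta) * ((Real.sqrt (8 * S.eta))⁻¹) ^ (j + 1))
      S.sweepingLoad := by
  set q : ℝ := Real.sqrt (8 * S.eta) with hq
  have hq1 : 1 < q := S.one_lt_sqrt_eight_mul hη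
  have hq0 : 0 < q := lt_trans one_pos hq1
  have hr0 : 0 ≤ q⁻¹ := inv_nonneg.2 hq0.le
  have hr1 : q⁻¹ < 1 := inv_lt_one_of_one_lt₀ hq1
  have hgeo := hasSum_geometric_of_lt_one hr0 hr1
  have h2 := hgeo.mul_left (Real.sqrt (1 - S.eta) * q⁻¹)
  have h3 : (fun j : ℕ => Real.sqrt (1 - S.eta) * q⁻¹ * q⁻¹ ^ j)
      = fun j : ℕ => Real.sqrt (1 - S.eta) * q⁻¹ ^ (j + 1) := by
    funext j; rw [pow_succ]; ring
  rw [h3] at h2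
  have hq1' : q - 1 ≠ 0 := by linarith
  have h1q : 1 - q⁻¹ ≠ 0 := by
    have : q⁻¹ < 1 := hr1
    linarith
  have hval : Real.sqrt (1 - S.eta) * q⁻¹ * (1 - q⁻¹)⁻¹ = S.sweepingLoad := by
    unfold sweepingLoad
    rw [← hq]
    field_simp
  rw [hval] at h2
  exact h2

end CascadeSpecs

end Literature.Analysis.FluidPDE.FluidComputer

end
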